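import Literature.Computability.Cryptography.ChenQuantumLWEGeneralMeasurement
import Mathlib.Analysis.InnerProductSpace.PiL2

/-!
# Chen 2024 (withdrawn), Step 8: the ε-ROBUST information ceiling for general measurements (POVMs)

REPRODUCTION / ANALYSIS OF A CLAIMED RESULT UNDER ADJUDICATION — header required by the tree's literature
rule.  Author: Yilei Chen.  Title: *Quantum Algorithms for Lattice Problems*.  Venue: IACR Cryptology ePrint
Archive, Paper 2024/555, version of 18 April 2024 (the main claim WITHDRAWN by the author, title-page note;
the bug is in Step 9, p. 37). [ChenQuantumLattice2024]  Printed page numbers.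

HONEST FRAMING (bundle `papers/QuantumAdvantage/lwe-quantum-autopsy/`, Part 1, generation 7): the value of
this file is a THEOREM / precise negative result about one step of a withdrawn algorithm — NOT summit
progress, no cryptanalytic claim in either direction (nothing here says LWE is quantumly easy or hard).

WHAT IS DONE HERE.  `ChenQuantumLWEGeneralMeasurement.lean` proved the Step-8 ceiling for every general
measurement (POVM, any outcome type) that is SURE on the class of instances consistent with the public data
(`Shape.SureOn`: one CERTAIN outcome, Born weight exactly `⟨φ7.d|φ7.d⟩`, on `|φ7.d⟩` of every class
instance — exact non-demolition, which is what Lemma 3.13 literally requires, "this measurement does not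
collapse the state", p. 34).  Its scope note left open the APPROXIMATE regime: an algorithm only needs its
intermediate measurements to succeed with probability `1 − negl`.  This file removes that caveat.  It
quantifies over the SAME class of POVMs, now only `ε`-ALMOST SURE on the class (`Shape.AlmostSureOn`: on
every class instance SOME outcome has weight `≥ (1 − ε)·⟨φ7.d|φ7.d⟩`, `POVM.AlmostCertain`), and proves the
same conclusion with the tolerance EXPLICIT IN THE PARAMETERS `P = p₁Q` (register modulus `M = 2D²P`):

    `4 · ε · P² < 1`.

* `POVM.norm_sq_dotProduct_le_of_almostCertain` — the mechanism, a two-state discrimination bound: if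
  outcome `k` has weight `≥ (1−ε)⟨ψ|ψ⟩` on `ψ` and a DIFFERENT outcome `k′` has weight `≥ (1−ε)⟨φ|φ⟩` on
  `φ`, then `|⟨ψ|φ⟩|² ≤ 4ε·⟨ψ|ψ⟩⟨φ|φ⟩`.  Proof: `⟨ψ|φ⟩ = ⟨ψ|E_{k′}|φ⟩ + ⟨ψ|(1−E_{k′})|φ⟩`, Cauchy–Schwarz for
  the two positive semidefinite forms `E_{k′}` and `1 − E_{k′}` (`Matrix.PosSemidef` as `B†B`,
  `CStarAlgebra.nonneg_iff_eq_star_mul_self`), and `⟨ψ|E_{k′}|ψ⟩ ≤ ε⟨ψ|ψ⟩`, `⟨φ|(1−E_{k′})|φ⟩ ≤ ε⟨φ|φ⟩`.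
  (`ε = 0`: certain outcomes on non-orthogonal states coincide, gen 6's `POVM.eq_of_certain_of_dotProduct_ne_zero`.
  The constant `4` is asymptotically sharp — for two pure states of normalised overlap `δ` the Helstrom
  measurement errs with probability `(1 − √(1−δ²))/2 = δ²/4 + O(δ⁴)` on each; a remark, not used or proved.)
  `POVM.almostCertain_unique`: on one state two `ε`-almost-certain outcomes coincide when `ε < 1/2`.
* QUANTITATIVE RIGIDITY of the three moves of gen 6 (`Shape.overlap_same_offset`, `Shape.overlap_moveT`,
  `Shape.overlap_moveC`, from `Shape.overlap_of_rigid`): for each pair of instances `(b₂,v₂) ~ (b₃,v₃)`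
  linked by a move, `⟨ψ₂|ψ₂⟩·⟨ψ₃|ψ₃⟩ ≤ P²·|⟨ψ₂|ψ₃⟩|²` (`ψᵢ = |φ7.d(bᵢ,vᵢ)⟩`; normalised overlap `≥ 1/P`).
  Ingredients: at coinciding branches of `|φ7⟩` (eq. (35)) the amplitude product is ONE unimodular `ζ`, so
  `⟨φ7₂|φ7₃⟩ = ζ·#(common points)` (`dotProduct_eq_card_mul_of_rigid`); the witness branches `(j₀, j₀′)` of
  the move coincide for ALL `2ⁿ` tails `k`, so `#(common points) ≥ 2ⁿ`; `⟨φ7|φ7⟩ = P·2ⁿ`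
  (`Shape.card_support_phi7`); and Step 8 scales every inner product of two instances by the same factor
  `(MD)^{n+1}` (`Shape.dot_phi7d_inst_phi7`: polarised Plancherel and the unimodular kick from gen 6, plus
  the fibre count `Shape.sum_comp_D_mul` — each point of `Dℤ_M^{n+1}` has `D^{n+1}` preimages under `×D`).
* `Shape.step8_povm_ceiling_robust` — **the robust ceiling.**  Public data fixed, `U ∋ t₁+1` the coordinates
  on which `b` is unknown, `E` any POVM `ε`-almost sure on the class, `4εP² < 1`.  Then the almost-certain
  outcome is the same on `(b₂,v₂)` and `(b₃,v₃)` whenever `v₃ ≡ v₂ + 2D²p₁(a·b₂ + m) (mod M)`, `a ∈ ℤ`,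
  `m ∈ ℤ^{n+1}` supported on `U ∖ {0}`, for ANY `b₃` of the class — the chain `C·A·T·A` of gen 6, each link
  by the two bullets above, the last step by `almostCertain_unique` (`4εP² < 1 ⇒ ε < 1/2`).  Corollaries:
  `Shape.step8_cannot_supply_step9Needs_povm_robust` (`…'` for the full class): an admissible instance with
  the SAME `b`, the same `step8Output = v′₀ mod D²p₁` and a DIFFERENT `step9Needs = v′₀ mod D²P` receives
  the same almost-certain outcome as `S`; `Shape.step9Needs_not_almostSurely_measurable`: NO POVM with
  outcomes in `ℤ_N` returns, on `|φ7.d⟩` of every admissible instance, that instance's `step9Needs` with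
  weight `≥ (1−ε)⟨φ7.d|φ7.d⟩`.  The exact ceiling of gen 6 is the case `ε = 0` (a sure POVM is `0`-almost
  sure, `Shape.SureOn.almostSureOn`, `POVM.Certain.almostCertain`; not restated).

SCOPE (honest).  (a) The tolerance is explicit but only inverse-polynomial in `P`: `P = p₁Q ≥ 9`, so
`ε < 1/(4P²) ≤ 1/324` always qualifies; under the source's Cond. C.3/C.6 (`p₁ ∈ O(1)`, `Q` quasi-polynomial
in `n`) `1/(4P²)` is inverse-QUASI-POLYNOMIAL in `n`, not `2^{−Ω(n)}` — an algorithm whose Step-8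
measurement disturbed `|φ7⟩` by more than that on some class instance is not excluded by THIS theorem (it is
by Lemma 3.13's own requirement).  (b) The `P²` comes from chaining moves of overlap exactly `1/P` (one
common branch `j` out of `P`); whether a cleverer chain improves the exponent is not pursued.  (c) As in
gen 6 the statement is about the Step-8 register state `|φ7.d⟩` of eq. (35)/§3.5.8 as formalised in
`ChenQuantumLWESteps` / `ChenQuantumLWEStepEight`, for the class `Shape.InClass`; nothing is said about other
algorithms for LWE.

Everything is `sorry`-free over Mathlib (`inner_mul_inner_self_le` on `EuclideanSpace`,
`CStarAlgebra.nonneg_iff_eq_star_mul_self` for `Matrix.PosSemidef`).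
-/


namespace Literature.Computability.Cryptography.Chen2024

open scoped BigOperators ComplexOrder MatrixOrder
open Matrix WithLp

/-! ### Cauchy–Schwarz for vectors and for positive semidefinite forms -/

/-- `‖⟨u|w⟩‖² ≤ ⟨u|u⟩·⟨w|w⟩` for amplitude vectors. [folklore] -/
theorem norm_sq_star_dotProduct_le {X : Type*} [Fintype X] (u w : X → ℂ) :
    ‖star u ⬝ᵥ w‖ ^ 2 ≤ (star u ⬝ᵥ u).re * (star w ⬝ᵥ w).re := by
  have h1 : star u ⬝ᵥ w = inner ℂ (toLp 2 u : EuclideanSpace ℂ X) (toLp 2 w) := by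
    rw [EuclideanSpace.inner_toLp_toLp, dotProduct_comm]
  have h2 : star u ⬝ᵥ u = inner ℂ (toLp 2 u : EuclideanSpace ℂ X) (toLp 2 u) := by
    rw [EuclideanSpace.inner_toLp_toLp, dotProduct_comm]
  have h3 : star w ⬝ᵥ w = inner ℂ (toLp 2 w : EuclideanSpace ℂ X) (toLp 2 w) := by
    rw [EuclideanSpace.inner_toLp_toLp, dotProduct_comm]
  have key := inner_mul_inner_self_le (𝕜 := ℂ) (toLp 2 u : EuclideanSpace ℂ X) (toLp 2 w)
  rw [← norm_inner_symm (𝕜 := ℂ) (toLp 2 u : EuclideanSpace ℂ X) (toLp 2 w)] at key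
  rw [h1, h2, h3, sq]
  simpa using key

/-- Cauchy–Schwarz for the sesquilinear form of a positive semidefinite matrix:
`‖⟨ψ|A|φ⟩‖² ≤ ⟨ψ|A|ψ⟩·⟨φ|A|φ⟩`. [folklore] -/
theorem norm_sq_dotProduct_mulVec_le {X : Type*} [Fintype X] [DecidableEq X] {A : Matrix X X ℂ}
    (hA : A.PosSemidef) (ψ φ : X → ℂ) :
    ‖star ψ ⬝ᵥ (A *ᵥ φ)‖ ^ 2 ≤ (star ψ ⬝ᵥ (A *ᵥ ψ)).re * (star φ ⬝ᵥ (A *ᵥ φ)).re := by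
  obtain ⟨B, rfl⟩ := CStarAlgebra.nonneg_iff_eq_star_mul_self.mp hA.nonneg
  have key : ∀ x y : X → ℂ, star x ⬝ᵥ ((star B * B) *ᵥ y) = star (B *ᵥ x) ⬝ᵥ (B *ᵥ y) := by
    intro x y
    rw [← Matrix.mulVec_mulVec, dotProduct_mulVec, star_eq_conjTranspose, vecMul_conjTranspose, star_star]
  rw [key, key, key]
  exact norm_sq_star_dotProduct_le _ _

/-- `⟨ψ|ψ⟩` is real. [folklore] -/
theorem star_dotProduct_self_im {X : Type*} [Fintype X] (ψ : X → ℂ) : (star ψ ⬝ᵥ ψ).im = 0 :=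
  ((Complex.nonneg_iff.1 (dotProduct_star_self_nonneg ψ)).2).symm

/-- `0 ≤ ⟨ψ|ψ⟩`. [folklore] -/
theorem star_dotProduct_self_re_nonneg {X : Type*} [Fintype X] (ψ : X → ℂ) : 0 ≤ (star ψ ⬝ᵥ ψ).re :=
  (Complex.nonneg_iff.1 (dotProduct_star_self_nonneg ψ)).1

/-- `0 < ⟨ψ|ψ⟩` for `ψ ≠ 0`. [folklore] -/
theorem star_dotProduct_self_re_pos {X : Type*} [Fintype X] {ψ : X → ℂ} (hψ : ψ ≠ 0) :
    0 < (star ψ ⬝ᵥ ψ).re := by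
  have h := star_dotProduct_self_re_nonneg ψ
  rcases h.lt_or_eq with h | h
  · exact h
  · exfalso
    apply hψ
    rw [← dotProduct_star_self_eq_zero]
    exact Complex.ext h.symm (star_dotProduct_self_im ψ)

namespace POVM

variable {X κ : Type*} [Fintype X] [DecidableEq X] [Fintype κ] (E : POVM X κ)

/-- Outcome `k` is `ε`-ALMOST CERTAIN on `ψ`: its Born weight is at least `(1 − ε)⟨ψ|ψ⟩` (probability
`≥ 1 − ε` when `ψ ≠ 0`). `Certain` is the case `ε = 0`. [cite: NielsenChuang2010, §2.2.6 p. 90] -/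
def AlmostCertain (ε : ℝ) (ψ : X → ℂ) (k : κ) : Prop := (1 - ε) * (star ψ ⬝ᵥ ψ).re ≤ (E.weight ψ k).re

/-- Weights have non-negative real part. [cite: NielsenChuang2010, §2.2.6 p. 90] -/
theorem weight_re_nonneg (ψ : X → ℂ) (k : κ) : 0 ≤ (E.weight ψ k).re :=
  (Complex.nonneg_iff.1 (E.weight_nonneg ψ k)).1

/-- The real parts of the weights sum to `⟨ψ|ψ⟩`. [cite: NielsenChuang2010, §2.2.6 p. 90] -/
theorem sum_weight_re (ψ : X → ℂ) : ∑ k, (E.weight ψ k).re = (star ψ ⬝ᵥ ψ).re := by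
  rw [← Complex.re_sum, E.sum_weight]

/-- A certain outcome is `ε`-almost certain for every `ε ≥ 0`. [cite: NielsenChuang2010, §2.2.6 p. 90] -/
theorem Certain.almostCertain {ψ : X → ℂ} {k : κ} (h : E.Certain ψ k) {ε : ℝ} (hε : 0 ≤ ε) :
    E.AlmostCertain ε ψ k := by
  unfold AlmostCertain
  unfold Certain at h
  rw [h]
  have := star_dotProduct_self_re_nonneg ψ
  nlinarith

/-- Two weights are at most the total. [cite: NielsenChuang2010, §2.2.6 p. 90] -/
theorem weight_re_add_weight_re_le [DecidableEq κ] (ψ : X → ℂ) {k k' : κ} (hkk : k ≠ k') :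
    (E.weight ψ k).re + (E.weight ψ k').re ≤ (star ψ ⬝ᵥ ψ).re := by
  rw [← E.sum_weight_re ψ, ← Finset.add_sum_erase _ _ (Finset.mem_univ k),
    ← Finset.add_sum_erase _ _ (Finset.mem_erase.2 ⟨Ne.symm hkk, Finset.mem_univ k'⟩), ← add_assoc]
  have : 0 ≤ ∑ x ∈ (Finset.univ.erase k).erase k', (E.weight ψ x).re :=
    Finset.sum_nonneg fun l _ => E.weight_re_nonneg ψ l
  linarith

/-- One weight is at most the total. [cite: NielsenChuang2010, §2.2.6 p. 90] -/
theorem weight_re_le [DecidableEq κ] (ψ : X → ℂ) (k : κ) : (E.weight ψ k).re ≤ (star ψ ⬝ᵥ ψ).re := by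
  rw [← E.sum_weight_re ψ, ← Finset.add_sum_erase _ _ (Finset.mem_univ k)]
  have : 0 ≤ ∑ x ∈ Finset.univ.erase k, (E.weight ψ x).re :=
    Finset.sum_nonneg fun l _ => E.weight_re_nonneg ψ l
  linarith

/-- The complement `1 − E_k = Σ_{l ≠ k} E_l` of an effect is positive semidefinite. [cite: NielsenChuang2010, §2.2.6 p. 90] -/
theorem posSemidef_one_sub [DecidableEq κ] (k : κ) : (1 - E.effect k).PosSemidef := by
  have h : 1 - E.effect k = ∑ l ∈ Finset.univ.erase k, E.effect l := by
    rw [Finset.sum_erase_eq_sub (Finset.mem_univ k), E.sum_eq_one]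
  rw [h]
  exact Matrix.posSemidef_sum _ fun l _ => E.posSemidef l

/-- The weight of the complement: `⟨ψ|(1 − E_k)|ψ⟩ = ⟨ψ|ψ⟩ − ⟨ψ|E_k|ψ⟩`. [cite: NielsenChuang2010, §2.2.6 p. 90] -/
theorem dotProduct_one_sub_mulVec (ψ φ : X → ℂ) (k : κ) :
    star ψ ⬝ᵥ ((1 - E.effect k) *ᵥ φ) = star ψ ⬝ᵥ φ - star ψ ⬝ᵥ (E.effect k *ᵥ φ) := by
  rw [Matrix.sub_mulVec, Matrix.one_mulVec, dotProduct_sub]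

/-- **Robust form of the mechanism (almost-certain outcomes of two states with large overlap coincide).**
If outcome `k` is `ε`-almost certain on `ψ` and outcome `k′ ≠ k` is `ε`-almost certain on `φ`, then
`‖⟨ψ|φ⟩‖² ≤ 4ε·⟨ψ|ψ⟩⟨φ|φ⟩`: split `⟨ψ|φ⟩ = ⟨ψ|E_{k′}|φ⟩ + ⟨ψ|(1−E_{k′})|φ⟩` and apply Cauchy–Schwarz to
both positive forms (`⟨ψ|E_{k′}|ψ⟩ ≤ ε⟨ψ|ψ⟩`, `⟨φ|(1−E_{k′})|φ⟩ ≤ ε⟨φ|φ⟩`).  The constant `4` is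
asymptotically sharp (two pure states with overlap `δ` are discriminated with error
`(1 − √(1 − δ²))/2 = δ²/4 + O(δ⁴)` by the Helstrom measurement). [cite: NielsenChuang2010, Box 2.3 p. 87, §9.2 pp. 403–409] -/
theorem norm_sq_dotProduct_le_of_almostCertain [DecidableEq κ] {ε : ℝ} {ψ φ : X → ℂ} {k k' : κ}
    (hψ : E.AlmostCertain ε ψ k) (hφ : E.AlmostCertain ε φ k') (hkk : k ≠ k') :
    ‖star ψ ⬝ᵥ φ‖ ^ 2 ≤ 4 * ε * ((star ψ ⬝ᵥ ψ).re * (star φ ⬝ᵥ φ).re) := by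
  set Nψ := (star ψ ⬝ᵥ ψ).re with hNψ
  set Nφ := (star φ ⬝ᵥ φ).re with hNφ
  have hNψ0 : 0 ≤ Nψ := star_dotProduct_self_re_nonneg ψ
  have hNφ0 : 0 ≤ Nφ := star_dotProduct_self_re_nonneg φ
  -- the split
  have hsplit : star ψ ⬝ᵥ φ
      = star ψ ⬝ᵥ (E.effect k' *ᵥ φ) + star ψ ⬝ᵥ ((1 - E.effect k') *ᵥ φ) := by
    rw [E.dotProduct_one_sub_mulVec, add_sub_cancel]
  -- the four diagonal bounds
  have a1 : (star ψ ⬝ᵥ (E.effect k' *ᵥ ψ)).re ≤ ε * Nψ := by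
    have h2 := E.weight_re_add_weight_re_le ψ hkk
    unfold AlmostCertain at hψ
    show (E.weight ψ k').re ≤ ε * Nψ
    linarith
  have a1' : 0 ≤ (star ψ ⬝ᵥ (E.effect k' *ᵥ ψ)).re := E.weight_re_nonneg ψ k'
  have a2 : (star φ ⬝ᵥ (E.effect k' *ᵥ φ)).re ≤ Nφ := E.weight_re_le φ k'
  have a2' : 0 ≤ (star φ ⬝ᵥ (E.effect k' *ᵥ φ)).re := E.weight_re_nonneg φ k'
  have b1 : (star ψ ⬝ᵥ ((1 - E.effect k') *ᵥ ψ)).re ≤ Nψ := by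
    rw [E.dotProduct_one_sub_mulVec, Complex.sub_re]
    have := E.weight_re_nonneg ψ k'
    unfold weight at this
    linarith
  have b1' : 0 ≤ (star ψ ⬝ᵥ ((1 - E.effect k') *ᵥ ψ)).re :=
    (Complex.nonneg_iff.1 ((E.posSemidef_one_sub k').dotProduct_mulVec_nonneg ψ)).1
  have b2 : (star φ ⬝ᵥ ((1 - E.effect k') *ᵥ φ)).re ≤ ε * Nφ := by
    rw [E.dotProduct_one_sub_mulVec, Complex.sub_re]
    unfold AlmostCertain weight at hφ
    linarith
  have b2' : 0 ≤ (star φ ⬝ᵥ ((1 - E.effect k') *ᵥ φ)).re :=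
    (Complex.nonneg_iff.1 ((E.posSemidef_one_sub k').dotProduct_mulVec_nonneg φ)).1
  -- Cauchy–Schwarz twice
  have csA := norm_sq_dotProduct_mulVec_le (E.posSemidef k') ψ φ
  have csB := norm_sq_dotProduct_mulVec_le (E.posSemidef_one_sub k') ψ φ
  have hA : ‖star ψ ⬝ᵥ (E.effect k' *ᵥ φ)‖ ^ 2 ≤ ε * Nψ * Nφ :=
    csA.trans (by nlinarith [mul_le_mul a1 a2 a2' (by nlinarith)])
  have hB : ‖star ψ ⬝ᵥ ((1 - E.effect k') *ᵥ φ)‖ ^ 2 ≤ Nψ * (ε * Nφ) :=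
    csB.trans (by nlinarith [mul_le_mul b1 b2 b2' hNψ0])
  -- `‖x + y‖² ≤ 2‖x‖² + 2‖y‖²`
  have htri := norm_add_le (star ψ ⬝ᵥ (E.effect k' *ᵥ φ)) (star ψ ⬝ᵥ ((1 - E.effect k') *ᵥ φ))
  rw [← hsplit] at htri
  have hn0 : 0 ≤ ‖star ψ ⬝ᵥ φ‖ := norm_nonneg _
  nlinarith [sq_nonneg (‖star ψ ⬝ᵥ (E.effect k' *ᵥ φ)‖ - ‖star ψ ⬝ᵥ ((1 - E.effect k') *ᵥ φ)‖),
    norm_nonneg (star ψ ⬝ᵥ (E.effect k' *ᵥ φ)), norm_nonneg (star ψ ⬝ᵥ ((1 - E.effect k') *ᵥ φ))]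

/-- Contrapositive: `ε`-almost-certain outcomes on two states whose normalised overlap `δ` satisfies
`δ² > 4ε` COINCIDE. [cite: NielsenChuang2010, Box 2.3 p. 87] -/
theorem eq_of_almostCertain_of_overlap [DecidableEq κ] {ε : ℝ} {ψ φ : X → ℂ} {k k' : κ}
    (hψ : E.AlmostCertain ε ψ k) (hφ : E.AlmostCertain ε φ k')
    (hov : 4 * ε * ((star ψ ⬝ᵥ ψ).re * (star φ ⬝ᵥ φ).re) < ‖star ψ ⬝ᵥ φ‖ ^ 2) : k = k' := by
  by_contra hkk
  exact absurd (E.norm_sq_dotProduct_le_of_almostCertain hψ hφ hkk) (not_le.2 hov)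

/-- On one non-zero state two `ε`-almost-certain outcomes coincide when `ε < 1/2`. [cite: NielsenChuang2010, §2.2.6 p. 90] -/
theorem almostCertain_unique [DecidableEq κ] {ε : ℝ} (hε : ε < 1 / 2) {ψ : X → ℂ} (hψ : ψ ≠ 0)
    {k k' : κ} (hk : E.AlmostCertain ε ψ k) (hk' : E.AlmostCertain ε ψ k') : k = k' := by
  by_contra hkk
  have h2 := E.weight_re_add_weight_re_le ψ hkk
  have hpos := star_dotProduct_self_re_pos hψ
  unfold AlmostCertain at hk hk'
  nlinarith

/-- The form used along the chain: `ε`-almost-certain outcomes on two NON-ORTHOGONAL states with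
`⟨ψ|ψ⟩⟨φ|φ⟩ ≤ c·|⟨ψ|φ⟩|²` coincide as soon as `4εc < 1`. [cite: NielsenChuang2010, Box 2.3 p. 87] -/
theorem eq_of_almostCertain_of_overlap_le [DecidableEq κ] {ε : ℝ} {ψ φ : X → ℂ} {k k' : κ}
    (hψ : E.AlmostCertain ε ψ k) (hφ : E.AlmostCertain ε φ k') {c : ℝ} (hc : 4 * ε * c < 1)
    (hov : (star ψ ⬝ᵥ ψ).re * (star φ ⬝ᵥ φ).re ≤ c * ‖star ψ ⬝ᵥ φ‖ ^ 2) (hne : star ψ ⬝ᵥ φ ≠ 0) :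
    k = k' := by
  apply E.eq_of_almostCertain_of_overlap hψ hφ
  have hpos : 0 < ‖star ψ ⬝ᵥ φ‖ ^ 2 := pow_pos (norm_pos_iff.2 hne) 2
  rcases le_or_gt ε 0 with hε | hε
  · have h0 : 4 * ε * ((star ψ ⬝ᵥ ψ).re * (star φ ⬝ᵥ φ).re) ≤ 0 :=
      mul_nonpos_of_nonpos_of_nonneg (by linarith)
        (mul_nonneg (star_dotProduct_self_re_nonneg ψ) (star_dotProduct_self_re_nonneg φ))
    linarith
  · calc 4 * ε * ((star ψ ⬝ᵥ ψ).re * (star φ ⬝ᵥ φ).re)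
        ≤ 4 * ε * (c * ‖star ψ ⬝ᵥ φ‖ ^ 2) := mul_le_mul_of_nonneg_left hov (by linarith)
      _ = (4 * ε * c) * ‖star ψ ⬝ᵥ φ‖ ^ 2 := by ring
      _ < 1 * ‖star ψ ⬝ᵥ φ‖ ^ 2 := mul_lt_mul_of_pos_right hc hpos
      _ = ‖star ψ ⬝ᵥ φ‖ ^ 2 := one_mul _

end POVM

/-! ### The rigidity count -/

/-- If `conj ψ(z)·φ(z)` takes one value `ζ` at every common support point then
`⟨ψ|φ⟩ = #(common support)·ζ`. [folklore] -/
theorem dotProduct_eq_card_mul_of_rigid {X : Type*} [Fintype X] (ψ φ : X → ℂ) {ζ : ℂ}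
    (hrig : ∀ z, ψ z ≠ 0 → φ z ≠ 0 → (starRingEnd ℂ) (ψ z) * φ z = ζ) :
    star ψ ⬝ᵥ φ = ((Finset.univ.filter fun z => ψ z ≠ 0 ∧ φ z ≠ 0).card : ℂ) * ζ := by
  have hpt : ∀ z, (starRingEnd ℂ) (ψ z) * φ z = if ψ z ≠ 0 ∧ φ z ≠ 0 then ζ else 0 := by
    intro z
    split_ifs with hz
    · exact hrig z hz.1 hz.2
    · rw [not_and_or, not_not, not_not] at hz
      rcases hz with hz | hz
      · rw [hz, map_zero, zero_mul]
      · rw [hz, mul_zero]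
  simp only [dotProduct, Pi.star_apply, Complex.star_def, hpt]
  rw [Finset.sum_ite, Finset.sum_const_zero, add_zero, Finset.sum_const, nsmul_eq_mul]

/-- In particular `⟨ψ|ψ⟩ = #(support)` when `ψ` is unimodular on its support. [folklore] -/
theorem star_dotProduct_self_eq_card {X : Type*} [Fintype X] (ψ : X → ℂ)
    (h1 : ∀ z, ψ z ≠ 0 → (starRingEnd ℂ) (ψ z) * ψ z = 1) :
    star ψ ⬝ᵥ ψ = ((Finset.univ.filter fun z => ψ z ≠ 0).card : ℂ) := by
  rw [dotProduct_eq_card_mul_of_rigid ψ ψ (ζ := 1) (fun z hz _ => h1 z hz), mul_one]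
  congr 2
  exact Finset.filter_congr fun z _ => and_self_iff

namespace Shape

variable (S : Shape)

/-! ### Pull-back along multiplication by `D` -/

/-- **(8.i)+(8.ii) multiply every sum by `D^{n+1}`.**  For `G` supported on `Dℤ_M^{n+1}`:
`Σ_{y ∈ ℤ_M^{n+1}} G(D·y) = D^{n+1}·Σ_z G(z)` (each point of `Dℤ_M^{n+1}` has exactly `D^{n+1}` preimages,
`sum_fibre_D_mul` coordinatewise). [cite: ChenQuantumLattice2024, Lemma 2.17 p. 14, §3.5.8 p. 33] -/
theorem sum_comp_D_mul (G : (Fin (S.n + 1) → ZMod S.M) → ℂ)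
    (hG : ∀ z, G z ≠ 0 → ∃ c : Fin (S.n + 1) → ℤ, z = fun i => ((((S.D : ℤ)) * c i : ℤ) : ZMod S.M)) :
    ∑ y : Fin (S.n + 1) → ZMod S.M, G (fun i => ((S.D : ℕ) : ZMod S.M) * y i)
      = ((S.D : ℕ) : ℂ) ^ (S.n + 1) * ∑ z, G z := by
  classical
  have hM : (((S.M : ℕ)) : ℤ) = ((S.D : ℕ) : ℕ) * ((2 * (S.D : ℕ) * (S.P : ℕ) : ℕ) : ℕ) := by
    rw [S.M_coe]
    push_cast
    ring
  -- fibre count over a point of `Dℤ`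
  have hfib : ∀ c : Fin (S.n + 1) → ℤ,
      (∑ y : Fin (S.n + 1) → ZMod S.M,
        if (fun i => ((S.D : ℕ) : ZMod S.M) * y i) = (fun i => ((((S.D : ℤ)) * c i : ℤ) : ZMod S.M))
          then (1 : ℂ) else 0)
        = ((S.D : ℕ) : ℂ) ^ (S.n + 1) := by
    intro c
    have h1 : ∀ y : Fin (S.n + 1) → ZMod S.M,
        (if (fun i => ((S.D : ℕ) : ZMod S.M) * y i) = (fun i => ((((S.D : ℤ)) * c i : ℤ) : ZMod S.M))
          then (1 : ℂ) else 0)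
          = ∏ i, (if ((S.D : ℕ) : ZMod S.M) * y i = ((((S.D : ℤ)) * c i : ℤ) : ZMod S.M)
              then (1 : ℂ) else 0) := by
      intro y
      by_cases hc : ∀ i, ((S.D : ℕ) : ZMod S.M) * y i = ((((S.D : ℤ)) * c i : ℤ) : ZMod S.M)
      · rw [if_pos (funext hc), eq_comm]
        exact Finset.prod_eq_one fun i _ => if_pos (hc i)
      · rw [if_neg (fun heq => hc (fun i => congr_fun heq i)), eq_comm, Finset.prod_eq_zero_iff]
        obtain ⟨i, hi⟩ := not_forall.1 hc
        exact ⟨i, Finset.mem_univ _, if_neg hi⟩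
    simp_rw [h1]
    rw [← Fintype.prod_sum (fun (i : Fin (S.n + 1)) (x : ZMod S.M) =>
      if ((S.D : ℕ) : ZMod S.M) * x = ((((S.D : ℤ)) * c i : ℤ) : ZMod S.M) then (1 : ℂ) else 0)]
    have h2 : ∀ i : Fin (S.n + 1), (∑ x : ZMod S.M,
        if ((S.D : ℕ) : ZMod S.M) * x = ((((S.D : ℤ)) * c i : ℤ) : ZMod S.M) then (1 : ℂ) else 0)
          = ((S.D : ℕ) : ℂ) := by
      intro i
      have key := sum_fibre_D_mul (S.M : ℕ) (S.D : ℕ) (2 * (S.D : ℕ) * (S.P : ℕ)) hM (c i) (fun _ => (1 : ℂ))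
      have key' : (∑ x : ZMod S.M,
          if ((S.D : ℕ) : ZMod S.M) * x = (((((S.D : ℕ) : ℤ)) * c i : ℤ) : ZMod S.M) then (1 : ℂ) else 0)
            = ((S.D : ℕ) : ℂ) := by
        rw [key]
        simp
      convert key' using 4
    simp_rw [h2]
    rw [Finset.prod_const, Finset.card_univ, Fintype.card_fin]
  -- main computation: sum over the fibres
  have hpt : ∀ y : Fin (S.n + 1) → ZMod S.M, G (fun i => ((S.D : ℕ) : ZMod S.M) * y i)
      = ∑ z, if (fun i => ((S.D : ℕ) : ZMod S.M) * y i) = z then G z else 0 := by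
    intro y
    rw [Fintype.sum_ite_eq]
  calc ∑ y : Fin (S.n + 1) → ZMod S.M, G (fun i => ((S.D : ℕ) : ZMod S.M) * y i)
      = ∑ y : Fin (S.n + 1) → ZMod S.M, ∑ z, (if (fun i => ((S.D : ℕ) : ZMod S.M) * y i) = z then G z else 0) :=
        Finset.sum_congr rfl fun y _ => hpt y
    _ = ∑ z, ∑ y : Fin (S.n + 1) → ZMod S.M, (if (fun i => ((S.D : ℕ) : ZMod S.M) * y i) = z then G z else 0) :=
        Finset.sum_comm
    _ = ∑ z, G z * ∑ y : Fin (S.n + 1) → ZMod S.M,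
          (if (fun i => ((S.D : ℕ) : ZMod S.M) * y i) = z then (1 : ℂ) else 0) := by
        refine Finset.sum_congr rfl fun z _ => ?_
        rw [Finset.mul_sum]
        refine Finset.sum_congr rfl fun y _ => ?_
        split_ifs <;> simp
    _ = ∑ z, G z * ((S.D : ℕ) : ℂ) ^ (S.n + 1) := by
        refine Finset.sum_congr rfl fun z _ => ?_
        by_cases hz : G z = 0
        · rw [hz, zero_mul, zero_mul]
        · obtain ⟨c, hc⟩ := hG z hz
          subst hc
          rw [hfib c]
    _ = ((S.D : ℕ) : ℂ) ^ (S.n + 1) * ∑ z, G z := by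
        rw [← Finset.sum_mul, mul_comm]

/-! ### The support of `|φ7⟩` has `P·2ⁿ` points, all of modulus one -/

/-- The support of `|φ7⟩` is the set of branch points `{pt7 j k : j < P, k ∈ {0,1}ⁿ}`, of size `P·2ⁿ`.
[cite: ChenQuantumLattice2024, eq. (35) p. 31] -/
theorem card_support_phi7 (h : S.Admissible) :
    (Finset.univ.filter fun z => S.phi7 z ≠ 0).card = (S.P : ℕ) * 2 ^ S.n := by
  have hset : (Finset.univ.filter fun z => S.phi7 z ≠ 0)
      = ((Finset.range (S.P : ℕ)) ×ˢ (Finset.univ : Finset (Fin S.n → Fin 2))).image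
          (fun jk => S.pt7 jk.1 jk.2) := by
    ext z
    simp only [Finset.mem_filter, Finset.mem_univ, true_and, Finset.mem_image, Finset.mem_product,
      Finset.mem_range, Prod.exists]
    constructor
    · intro hz
      obtain ⟨j, hj, k, rfl⟩ := S.exists_branch_of_phi7_ne_zero hz
      exact ⟨j, k, ⟨hj, trivial⟩, rfl⟩
    · rintro ⟨j, k, ⟨hj, -⟩, rfl⟩
      rw [S.phi7_apply_pt7 h hj]
      exact S.amp7_ne_zero j k
  rw [hset, Finset.card_image_of_injOn, Finset.card_product, Finset.card_range, Finset.card_univ,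
    Fintype.card_fun, Fintype.card_fin, Fintype.card_fin]
  rintro ⟨j, k⟩ hjk ⟨j', k'⟩ hjk' heq
  simp only [Finset.coe_product, Finset.coe_range, Finset.coe_univ, Set.mem_prod, Set.mem_Iio,
    Set.mem_univ, and_true] at hjk hjk'
  obtain ⟨hjj, hkk⟩ := S.pt7_inj h hjk hjk' heq
  exact Prod.ext hjj hkk

/-- `⟨φ7|φ7⟩ = P·2ⁿ` (the amplitudes are unimodular). [cite: ChenQuantumLattice2024, eq. (35) p. 31] -/
theorem star_phi7_dotProduct_phi7 (h : S.Admissible) :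
    star S.phi7 ⬝ᵥ S.phi7 = ((S.P : ℕ) : ℂ) * 2 ^ S.n := by
  rw [star_dotProduct_self_eq_card S.phi7, S.card_support_phi7 h]
  · norm_num
  · intro z hz
    obtain ⟨j, hj, k, rfl⟩ := S.exists_branch_of_phi7_ne_zero hz
    rw [S.phi7_apply_pt7 h hj]
    exact S.conj_amp7_mul_self j k

variable {S}

/-- `⟨φ7.b(b₂,v₂)|φ7.b(b₃,v₃)⟩ = D^{n+1}·⟨φ7(b₂,v₂)|φ7(b₃,v₃)⟩` — the pull-back along `×D` sees each point
of `Dℤ` exactly `D^{n+1}` times. [cite: ChenQuantumLattice2024, §3.5.8 p. 33] -/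
theorem dot_phi7b_inst (b₂ v₂ b₃ v₃ : Fin (S.n + 1) → ℤ) (h₃ : (S.inst b₃ v₃).Admissible) :
    star (S.inst b₂ v₂).phi7b ⬝ᵥ (S.inst b₃ v₃).phi7b
      = ((S.D : ℕ) : ℂ) ^ (S.n + 1) * (star (S.inst b₂ v₂).phi7 ⬝ᵥ (S.inst b₃ v₃).phi7) := by
  have hG : ∀ z : Fin (S.n + 1) → ZMod S.M,
      (starRingEnd ℂ) ((S.inst b₂ v₂).phi7 z) * (S.inst b₃ v₃).phi7 z ≠ 0 →
        ∃ c : Fin (S.n + 1) → ℤ, z = fun i => ((((S.D : ℤ)) * c i : ℤ) : ZMod S.M) := by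
    intro z hz
    have hz3 : (S.inst b₃ v₃).phi7 z ≠ 0 := fun h0 => hz (by rw [h0, mul_zero])
    obtain ⟨j, -, k, hjk⟩ := (S.inst b₃ v₃).exists_branch_of_phi7_ne_zero hz3
    exact ⟨(S.inst b₃ v₃).ctr j k, hjk.trans ((S.inst b₃ v₃).pt7_eq_D_mul_ctr h₃ j k)⟩
  have key := S.sum_comp_D_mul
    (fun z => (starRingEnd ℂ) ((S.inst b₂ v₂).phi7 z) * (S.inst b₃ v₃).phi7 z) hG
  simp only [dotProduct, Pi.star_apply, Complex.star_def, Shape.phi7b_apply]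
  exact key

/-- `⟨φ7.d(b₂,v₂)|φ7.d(b₃,v₃)⟩ = (MD)^{n+1}·⟨φ7(b₂,v₂)|φ7(b₃,v₃)⟩`. [cite: ChenQuantumLattice2024, §3.5.8 p. 33] -/
theorem dot_phi7d_inst_phi7 (b₂ v₂ b₃ v₃ : Fin (S.n + 1) → ℤ) (h₃ : (S.inst b₃ v₃).Admissible) :
    star (S.inst b₂ v₂).phi7d ⬝ᵥ (S.inst b₃ v₃).phi7d
      = (((S.M : ℕ) : ℂ) * (S.D : ℕ)) ^ (S.n + 1)
          * (star (S.inst b₂ v₂).phi7 ⬝ᵥ (S.inst b₃ v₃).phi7) := by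
  rw [dot_phi7d_inst, dot_phi7b_inst b₂ v₂ b₃ v₃ h₃, mul_pow]
  ring

/-- `⟨φ7.d|φ7.d⟩ = (MD)^{n+1}·P·2ⁿ` for every admissible instance. [cite: ChenQuantumLattice2024, §3.5.8 p. 33] -/
theorem star_phi7d_dotProduct_phi7d_inst {b v : Fin (S.n + 1) → ℤ} (hI : (S.inst b v).Admissible) :
    star (S.inst b v).phi7d ⬝ᵥ (S.inst b v).phi7d
      = (((S.M : ℕ) : ℂ) * (S.D : ℕ)) ^ (S.n + 1) * (((S.P : ℕ) : ℂ) * 2 ^ S.n) := by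
  rw [dot_phi7d_inst_phi7 b v b v hI]
  congr 1
  exact (S.inst b v).star_phi7_dotProduct_phi7 hI

/-- **Quantitative rigidity.**  Under the rigidity hypothesis of `dot_phi7d_ne_zero_of_rigid` with a
UNIMODULAR `ζ` and a witness pair of branches `(j₀, j₀′)` coinciding for EVERY tail `k` (so at least `2ⁿ`
coincidences), the normalised overlap of `|φ7.d(b₂,v₂)⟩` and `|φ7.d(b₃,v₃)⟩` is at least `1/P`:
`⟨ψ₂|ψ₂⟩⟨ψ₃|ψ₃⟩ ≤ P²·‖⟨ψ₂|ψ₃⟩‖²`. [cite: ChenQuantumLattice2024, eq. (35) p. 31, §3.5.8 p. 33] -/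
theorem overlap_of_rigid {b₂ v₂ b₃ v₃ : Fin (S.n + 1) → ℤ} (h₂ : (S.inst b₂ v₂).Admissible)
    (h₃ : (S.inst b₃ v₃).Admissible) {ζ : ℂ} (hζ : ‖ζ‖ = 1)
    (hrig : ∀ (j : ℕ) (k : Fin S.n → Fin 2) (j' : ℕ) (k' : Fin S.n → Fin 2), j < (S.P : ℕ) → j' < (S.P : ℕ) →
      (S.inst b₂ v₂).pt7 j k = (S.inst b₃ v₃).pt7 j' k' →
        (starRingEnd ℂ) (S.amp7 j k) * S.amp7 j' k' = ζ)
    {j₀ j₀' : ℕ} (hj₀ : j₀ < (S.P : ℕ)) (hj₀' : j₀' < (S.P : ℕ))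
    (hwit : ∀ k : Fin S.n → Fin 2, (S.inst b₂ v₂).pt7 j₀ k = (S.inst b₃ v₃).pt7 j₀' k) :
    (star (S.inst b₂ v₂).phi7d ⬝ᵥ (S.inst b₂ v₂).phi7d).re
        * (star (S.inst b₃ v₃).phi7d ⬝ᵥ (S.inst b₃ v₃).phi7d).re
      ≤ ((S.P : ℕ) : ℝ) ^ 2 * ‖star (S.inst b₂ v₂).phi7d ⬝ᵥ (S.inst b₃ v₃).phi7d‖ ^ 2 := by
  -- the rigidity count on `|φ7⟩`
  have hrig' : ∀ z : Fin (S.n + 1) → ZMod S.M, (S.inst b₂ v₂).phi7 z ≠ 0 → (S.inst b₃ v₃).phi7 z ≠ 0 →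
      (starRingEnd ℂ) ((S.inst b₂ v₂).phi7 z) * (S.inst b₃ v₃).phi7 z = ζ := by
    intro z hz₂ hz₃
    obtain ⟨j, hj, k, hjk⟩ := (S.inst b₂ v₂).exists_branch_of_phi7_ne_zero hz₂
    obtain ⟨j', hj', k', hjk'⟩ := (S.inst b₃ v₃).exists_branch_of_phi7_ne_zero hz₃
    have hco : (S.inst b₂ v₂).pt7 j k = (S.inst b₃ v₃).pt7 j' k' := hjk.symm.trans hjk'
    have e₂ : (S.inst b₂ v₂).phi7 z = S.amp7 j k := by
      rw [hjk]
      exact (S.inst b₂ v₂).phi7_apply_pt7 h₂ hj k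
    have e₃ : (S.inst b₃ v₃).phi7 z = S.amp7 j' k' := by
      rw [hjk']
      exact (S.inst b₃ v₃).phi7_apply_pt7 h₃ hj' k'
    rw [e₂, e₃]
    exact hrig j k j' k' hj hj' hco
  have hdot : star (S.inst b₂ v₂).phi7 ⬝ᵥ (S.inst b₃ v₃).phi7
      = ((Finset.univ.filter fun z : Fin (S.n + 1) → ZMod S.M =>
          (S.inst b₂ v₂).phi7 z ≠ 0 ∧ (S.inst b₃ v₃).phi7 z ≠ 0).card : ℂ) * ζ :=
    dotProduct_eq_card_mul_of_rigid _ _ hrig'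
  -- at least `2ⁿ` coincidences
  have hcount : 2 ^ S.n ≤ (Finset.univ.filter fun z : Fin (S.n + 1) → ZMod S.M =>
      (S.inst b₂ v₂).phi7 z ≠ 0 ∧ (S.inst b₃ v₃).phi7 z ≠ 0).card := by
    have hsub : (Finset.univ : Finset (Fin S.n → Fin 2)).image (fun k => (S.inst b₂ v₂).pt7 j₀ k)
        ⊆ Finset.univ.filter fun z : Fin (S.n + 1) → ZMod S.M =>
          (S.inst b₂ v₂).phi7 z ≠ 0 ∧ (S.inst b₃ v₃).phi7 z ≠ 0 := by
      intro z hz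
      obtain ⟨k, -, rfl⟩ := Finset.mem_image.1 hz
      refine Finset.mem_filter.2 ⟨Finset.mem_univ _, ?_, ?_⟩
      · rw [(S.inst b₂ v₂).phi7_apply_pt7 h₂ hj₀]
        exact (S.inst b₂ v₂).amp7_ne_zero j₀ k
      · rw [hwit k, (S.inst b₃ v₃).phi7_apply_pt7 h₃ hj₀']
        exact (S.inst b₃ v₃).amp7_ne_zero j₀' k
    have hcard : ((Finset.univ : Finset (Fin S.n → Fin 2)).image
        (fun k => (S.inst b₂ v₂).pt7 j₀ k)).card = 2 ^ S.n := by
      rw [Finset.card_image_of_injective, Finset.card_univ, Fintype.card_fun, Fintype.card_fin,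
        Fintype.card_fin]
      intro k k' hkk
      exact ((S.inst b₂ v₂).pt7_inj h₂ hj₀ hj₀ hkk).2
    rw [← hcard]
    exact Finset.card_le_card hsub
  -- the norms
  have hΛ0 : (0 : ℝ) ≤ (((S.M : ℕ) : ℝ) * (S.D : ℕ)) ^ (S.n + 1) := by positivity
  have hΛC : ((((S.M : ℕ) : ℂ) * (S.D : ℕ)) ^ (S.n + 1))
      = ((((((S.M : ℕ) : ℝ) * (S.D : ℕ)) ^ (S.n + 1) : ℝ)) : ℂ) := by
    push_cast
    ring
  have hPC : (((S.P : ℕ) : ℂ) * 2 ^ S.n) = (((((S.P : ℕ) : ℝ) * 2 ^ S.n) : ℝ) : ℂ) := by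
    push_cast
    ring
  have hN : ∀ {b v : Fin (S.n + 1) → ℤ}, (S.inst b v).Admissible →
      (star (S.inst b v).phi7d ⬝ᵥ (S.inst b v).phi7d).re
        = (((S.M : ℕ) : ℝ) * (S.D : ℕ)) ^ (S.n + 1) * (((S.P : ℕ) : ℝ) * 2 ^ S.n) := by
    intro b v hI
    rw [star_phi7d_dotProduct_phi7d_inst hI, hΛC, hPC, ← Complex.ofReal_mul, Complex.ofReal_re]
  have hO : ‖star (S.inst b₂ v₂).phi7d ⬝ᵥ (S.inst b₃ v₃).phi7d‖
      = (((S.M : ℕ) : ℝ) * (S.D : ℕ)) ^ (S.n + 1)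
        * ((Finset.univ.filter fun z : Fin (S.n + 1) → ZMod S.M =>
            (S.inst b₂ v₂).phi7 z ≠ 0 ∧ (S.inst b₃ v₃).phi7 z ≠ 0).card : ℝ) := by
    rw [dot_phi7d_inst_phi7 b₂ v₂ b₃ v₃ h₃, hΛC, hdot, norm_mul, norm_mul, hζ, mul_one,
      Complex.norm_real, Complex.norm_natCast, Real.norm_of_nonneg hΛ0]
  rw [hN h₂, hN h₃, hO]
  have hc : (2 : ℝ) ^ S.n ≤ ((Finset.univ.filter fun z : Fin (S.n + 1) → ZMod S.M =>
      (S.inst b₂ v₂).phi7 z ≠ 0 ∧ (S.inst b₃ v₃).phi7 z ≠ 0).card : ℝ) := by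
    exact_mod_cast hcount
  have h20 : (0 : ℝ) ≤ 2 ^ S.n := by positivity
  have htC := mul_le_mul hc hc h20 (h20.trans hc)
  have hsq : (0 : ℝ) ≤ ((((S.M : ℕ) : ℝ) * (S.D : ℕ)) ^ (S.n + 1) * (S.P : ℕ)) ^ 2 := sq_nonneg _
  calc (((S.M : ℕ) : ℝ) * (S.D : ℕ)) ^ (S.n + 1) * (((S.P : ℕ) : ℝ) * 2 ^ S.n)
        * ((((S.M : ℕ) : ℝ) * (S.D : ℕ)) ^ (S.n + 1) * (((S.P : ℕ) : ℝ) * 2 ^ S.n))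
      = ((((S.M : ℕ) : ℝ) * (S.D : ℕ)) ^ (S.n + 1) * (S.P : ℕ)) ^ 2 * (2 ^ S.n * 2 ^ S.n) := by ring
    _ ≤ ((((S.M : ℕ) : ℝ) * (S.D : ℕ)) ^ (S.n + 1) * (S.P : ℕ)) ^ 2
        * (((Finset.univ.filter fun z : Fin (S.n + 1) → ZMod S.M =>
            (S.inst b₂ v₂).phi7 z ≠ 0 ∧ (S.inst b₃ v₃).phi7 z ≠ 0).card : ℝ)
          * ((Finset.univ.filter fun z : Fin (S.n + 1) → ZMod S.M =>
            (S.inst b₂ v₂).phi7 z ≠ 0 ∧ (S.inst b₃ v₃).phi7 z ≠ 0).card : ℝ)) :=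
        mul_le_mul_of_nonneg_left htC hsq
    _ = ((S.P : ℕ) : ℝ) ^ 2 * ((((S.M : ℕ) : ℝ) * (S.D : ℕ)) ^ (S.n + 1)
        * ((Finset.univ.filter fun z : Fin (S.n + 1) → ZMod S.M =>
            (S.inst b₂ v₂).phi7 z ≠ 0 ∧ (S.inst b₃ v₃).phi7 z ≠ 0).card : ℝ)) ^ 2 := by ring

end Shape

namespace Shape

variable (S : Shape)

/-! ### The three moves, quantitatively: normalised overlap at least `1/P` -/

/-- **Move A, quantitative.**  Two admissible instances with the same offset `v` satisfy
`⟨ψ₂|ψ₂⟩⟨ψ₃|ψ₃⟩ ≤ P²·|⟨ψ₂|ψ₃⟩|²` (`ψᵢ = |φ7.d(bᵢ,v)⟩`): rigid with `ζ = 1` and the branch `j = 0` common for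
every tail `k`. [cite: ChenQuantumLattice2024, eq. (35) p. 31, eq. (12) p. 17] -/
theorem overlap_same_offset (h : S.Admissible) {b₂ b₃ v : Fin (S.n + 1) → ℤ}
    (h₂ : (S.inst b₂ v).Admissible) (h₃ : (S.inst b₃ v).Admissible) :
    (star (S.inst b₂ v).phi7d ⬝ᵥ (S.inst b₂ v).phi7d).re
        * (star (S.inst b₃ v).phi7d ⬝ᵥ (S.inst b₃ v).phi7d).re
      ≤ ((S.P : ℕ) : ℝ) ^ 2 * ‖star (S.inst b₂ v).phi7d ⬝ᵥ (S.inst b₃ v).phi7d‖ ^ 2 := by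
  refine overlap_of_rigid h₂ h₃ (ζ := 1) norm_one ?_ (j₀ := 0) (j₀' := 0) S.P.pos S.P.pos ?_
  · intro j k j' k' hj hj' hco
    have hk : k = k' := coincidence_k (S.odd_P h) hco fun t => ⟨0, by ring⟩
    have hd := coincidence_head hco h₂.b_head h₃.b_head 0 (by ring)
    rw [sub_zero] at hd
    have hjj : j = j' := nat_eq_of_dvd_sub_of_lt hj hj' hd
    subst hk hjj
    exact S.conj_amp7_mul_self j k
  · intro k
    funext i
    rw [pt7_inst_apply, pt7_inst_apply]
    push_cast
    ring

/-- **Move T, quantitative.**  For `m ∈ ℤ^{n+1}` with `m₀ = 0`, the instances `(b, v)` and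
`(b − 2p₁m, v + 4D²p₁m)` satisfy `⟨ψ₂|ψ₂⟩⟨ψ₃|ψ₃⟩ ≤ P²·|⟨ψ₂|ψ₃⟩|²`: rigid with `ζ = 1` and the branch `j = 1`
common for every tail `k`. [cite: ChenQuantumLattice2024, eq. (35) p. 31, eq. (12) p. 17] -/
theorem overlap_moveT (h : S.Admissible) {b v : Fin (S.n + 1) → ℤ} (hI : (S.inst b v).Admissible)
    (m : Fin (S.n + 1) → ℤ) (hm : m 0 = 0) :
    (star (S.inst b v).phi7d ⬝ᵥ (S.inst b v).phi7d).re
        * (star (S.inst (fun i => b i - 2 * (S.p₁ : ℤ) * m i)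
              (fun i => v i + 4 * (S.D : ℤ) * S.D * S.p₁ * m i)).phi7d
            ⬝ᵥ (S.inst (fun i => b i - 2 * (S.p₁ : ℤ) * m i)
              (fun i => v i + 4 * (S.D : ℤ) * S.D * S.p₁ * m i)).phi7d).re
      ≤ ((S.P : ℕ) : ℝ) ^ 2 * ‖star (S.inst b v).phi7d ⬝ᵥ
          (S.inst (fun i => b i - 2 * (S.p₁ : ℤ) * m i)
            (fun i => v i + 4 * (S.D : ℤ) * S.D * S.p₁ * m i)).phi7d‖ ^ 2 := by
  have hb0 : b 0 = -1 := hI.b_head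
  have h₃ : (S.inst (fun i => b i - 2 * (S.p₁ : ℤ) * m i)
      (fun i => v i + 4 * (S.D : ℤ) * S.D * S.p₁ * m i)).Admissible := by
    refine S.inst_admissible h ?_ (fun i hi => ?_) (fun i => ?_)
    · show b 0 - 2 * (S.p₁ : ℤ) * m 0 = -1
      rw [hm, hb0]
      ring
    · exact dvd_sub (hI.b_tail i hi) ⟨m i, by ring⟩
    · exact dvd_add (hI.v'_in_DZ i) ⟨4 * S.D * S.p₁ * m i, by ring⟩
  refine overlap_of_rigid hI h₃ (ζ := 1) norm_one ?_ (j₀ := 1) (j₀' := 1) (S.one_lt_P h) (S.one_lt_P h) ?_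
  · intro j k j' k' hj hj' hco
    have hk : k = k' :=
      coincidence_k (S.odd_P h) hco fun t => ⟨2 * S.p₁ * m t.succ, by ring⟩
    have hd := coincidence_head hco hb0 (by show b 0 - 2 * (S.p₁ : ℤ) * m 0 = -1; rw [hm, hb0]; ring) 0
      (by show v 0 + 4 * (S.D : ℤ) * S.D * S.p₁ * m 0 - v 0 = _; rw [hm]; ring)
    rw [sub_zero] at hd
    have hjj : j = j' := nat_eq_of_dvd_sub_of_lt hj hj' hd
    subst hk hjj
    exact S.conj_amp7_mul_self j k
  · intro k
    funext i
    rw [pt7_inst_apply, pt7_inst_apply]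
    push_cast
    ring

/-- **Move C, quantitative.**  For a coordinate `t₁+1` and `a ∈ ℤ`, the instances `(b, v)` and
`(b − 2p₁e_{t₁+1}, v + 2D²p₁a·b)` satisfy `⟨ψ₂|ψ₂⟩⟨ψ₃|ψ₃⟩ ≤ P²·|⟨ψ₂|ψ₃⟩|²`: rigid with the unimodular
`ζ = e(p₁a²/Q)` and the branches `j = p₁a mod P`, `j′ = 0` coinciding for every tail `k`.
[cite: ChenQuantumLattice2024, eq. (35) p. 31, eq. (12) p. 17, Cond. C.3 p. 18] -/
theorem overlap_moveC (h : S.Admissible) {b v : Fin (S.n + 1) → ℤ} (hI : (S.inst b v).Admissible)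
    (t₁ : Fin S.n) (a : ℤ) :
    (star (S.inst b v).phi7d ⬝ᵥ (S.inst b v).phi7d).re
        * (star (S.inst (Function.update b t₁.succ (b t₁.succ - 2 * (S.p₁ : ℤ)))
              (fun i => v i + 2 * (S.D : ℤ) * S.D * S.p₁ * a * b i)).phi7d
            ⬝ᵥ (S.inst (Function.update b t₁.succ (b t₁.succ - 2 * (S.p₁ : ℤ)))
              (fun i => v i + 2 * (S.D : ℤ) * S.D * S.p₁ * a * b i)).phi7d).re
      ≤ ((S.P : ℕ) : ℝ) ^ 2 * ‖star (S.inst b v).phi7d ⬝ᵥ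
          (S.inst (Function.update b t₁.succ (b t₁.succ - 2 * (S.p₁ : ℤ)))
            (fun i => v i + 2 * (S.D : ℤ) * S.D * S.p₁ * a * b i)).phi7d‖ ^ 2 := by
  have hb0 : b 0 = -1 := hI.b_head
  have hb'0 : Function.update b t₁.succ (b t₁.succ - 2 * (S.p₁ : ℤ)) 0 = -1 := by
    rw [Function.update_of_ne (Fin.succ_ne_zero t₁).symm, hb0]
  have hb't : Function.update b t₁.succ (b t₁.succ - 2 * (S.p₁ : ℤ)) t₁.succ = b t₁.succ - 2 * (S.p₁ : ℤ) :=
    Function.update_self _ _ _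
  have h₃ : (S.inst (Function.update b t₁.succ (b t₁.succ - 2 * (S.p₁ : ℤ)))
      (fun i => v i + 2 * (S.D : ℤ) * S.D * S.p₁ * a * b i)).Admissible := by
    refine S.inst_admissible h hb'0 (fun i hi => ?_) (fun i => ?_)
    · by_cases hit : i = t₁.succ
      · subst hit
        rw [hb't]
        exact dvd_sub (hI.b_tail _ hi) ⟨1, by ring⟩
      · rw [Function.update_of_ne hit]
        exact hI.b_tail i hi
    · exact dvd_add (hI.v'_in_DZ i) ⟨2 * S.D * S.p₁ * a * b i, by ring⟩
  have hP0 : (0 : ℤ) < (S.P : ℕ) := by exact_mod_cast S.P.pos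
  have hj0 : (0 : ℤ) ≤ ((S.p₁ : ℤ) * a) % (S.P : ℕ) := Int.emod_nonneg _ hP0.ne'
  have hjlt' : (((S.p₁ : ℤ) * a) % (S.P : ℕ)) < (S.P : ℕ) := Int.emod_lt_of_pos _ hP0
  have hjlt : (((S.p₁ : ℤ) * a) % (S.P : ℕ)).toNat < (S.P : ℕ) := by
    have := Int.toNat_of_nonneg hj0
    omega
  refine overlap_of_rigid hI h₃ (ζ := e ((S.p₁ : ℚ) * a ^ 2 / S.Q)) (norm_e _) ?_
    (j₀ := (((S.p₁ : ℤ) * a) % (S.P : ℕ)).toNat) (j₀' := 0) hjlt S.P.pos ?_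
  · intro j k j' k' hj hj' hco
    have hk : k = k' :=
      coincidence_k (S.odd_P h) hco fun t => ⟨S.p₁ * a * b t.succ, by ring⟩
    obtain ⟨c, hc⟩ := coincidence_head hco hb0 hb'0 (-(S.p₁ * a))
      (by show v 0 + 2 * (S.D : ℤ) * S.D * S.p₁ * a * b 0 - v 0 = _; rw [hb0]; ring)
    obtain ⟨d, hd⟩ := coincidence_tail hco t₁ (congr_fun hk t₁) (S.p₁ * a * b t₁.succ) (by ring)
    rw [hb't] at hd
    have hP := S.P_coe
    have hu : 2 * (j' : ℤ) = S.Q * (d + b t₁.succ * c) := by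
      have hp : ((S.p₁ : ℕ) : ℤ) ≠ 0 := by exact_mod_cast S.p₁.ne_zero
      refine mul_left_cancel₀ hp ?_
      linear_combination hd + (b t₁.succ) * hc + (d + b t₁.succ * c) * hP
    obtain ⟨r, hr⟩ := h.odd_Q
    have hQ : ((S.Q : ℕ) : ℤ) = 2 * r + 1 := by exact_mod_cast hr
    have hj'Q : (j' : ℤ) = S.Q * ((r + 1) * (d + b t₁.succ * c) - j') := by
      linear_combination (r + 1 : ℤ) * hu + (j' : ℤ) * hQ
    have hjj : (j : ℤ) = j' + S.p₁ * a - S.P * c := by linear_combination (-1 : ℤ) * hc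
    subst hk
    exact S.conj_amp7_mul_amp7_moveC k a c _ hjj hj'Q
  · intro k
    have hjP : ((((S.p₁ : ℤ) * a) % (S.P : ℕ)).toNat : ℤ)
        = S.p₁ * a - (S.P : ℕ) * (((S.p₁ : ℤ) * a) / (S.P : ℕ)) := by
      rw [Int.toNat_of_nonneg hj0, Int.emod_def]
    funext i
    rw [pt7_inst_apply, pt7_inst_apply]
    refine (ZMod.intCast_eq_intCast_iff_dvd_sub _ _ (S.M : ℕ)).2 ?_
    rw [S.M_coe]
    refine ⟨b i * (((S.p₁ : ℤ) * a) / (S.P : ℕ)), ?_⟩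
    push_cast
    linear_combination (-2 * (S.D : ℤ) * S.D * b i) * hjP

/-! ### ε-almost-sure measurements on the class, and the robust ceiling -/

/-- A general measurement of the Step-8 register is `ε`-ALMOST SURE on the class if on `|φ7.d⟩` of every
instance of the class some outcome has Born weight at least `(1 − ε)·⟨φ7.d|φ7.d⟩` — the approximate form of
what Lemma 3.13 needs of the fifth operation of Step 8 (`ε = 0`: `SureOn`).
[cite: ChenQuantumLattice2024, Lemma 3.13 pp. 32–34] -/
def AlmostSureOn {κ : Type*} [Fintype κ] (ε : ℝ) (U : Finset (Fin (S.n + 1)))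
    (E : POVM (Fin (S.n + 1) → ZMod S.M) κ) : Prop :=
  ∀ b₂ v₂ : Fin (S.n + 1) → ℤ, S.InClass U b₂ v₂ → ∃ k, E.AlmostCertain ε (S.inst b₂ v₂).phi7d k

variable {S}

/-- A sure measurement is `ε`-almost sure for every `ε ≥ 0`. [cite: ChenQuantumLattice2024, Lemma 3.13 pp. 32–34] -/
theorem SureOn.almostSureOn {κ : Type*} [Fintype κ] {U : Finset (Fin (S.n + 1))}
    {E : POVM (Fin (S.n + 1) → ZMod S.M) κ} (hE : S.SureOn U E) {ε : ℝ} (hε : 0 ≤ ε) :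
    S.AlmostSureOn ε U E := by
  intro b₂ v₂ hI
  obtain ⟨k, hk⟩ := hE b₂ v₂ hI
  exact ⟨k, POVM.Certain.almostCertain E hk hε⟩

/-- If `4εP² < 1` then `ε < 1/2` (`P ≥ 2`). [cite: ChenQuantumLattice2024, Cond. C.3 p. 18] -/
theorem eps_lt_half (h : S.Admissible) {ε : ℝ} (hε : 4 * ε * ((S.P : ℕ) : ℝ) ^ 2 < 1) : ε < 1 / 2 := by
  have hP2 : (2 : ℝ) ≤ (S.P : ℕ) := by exact_mod_cast S.one_lt_P h
  have hP4 : (4 : ℝ) ≤ ((S.P : ℕ) : ℝ) ^ 2 := by nlinarith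
  by_contra hcon
  rw [not_lt] at hcon
  nlinarith [mul_nonneg (sub_nonneg.2 hcon) (sub_nonneg.2 hP4)]

variable (S)

/-- **The ROBUST general-measurement ceiling of Step 8.**  Let `U ∋ t₁+1` be the unknown coordinates, `E`
ANY POVM on the Step-8 register (any outcome type `κ`) that is `ε`-almost sure on the class, with the
tolerance explicit in the parameters: `4·ε·P² < 1` (`P = p₁Q`; with `M = 2D²P` the register modulus).
For instances `(b₂,v₂)`, `(b₃,v₃)` of the class with `v₃ ≡ v₂ + 2D²p₁(a·b₂ + m) (mod M)` (`a ∈ ℤ`,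
`m ∈ ℤ^{n+1}` supported on `U ∖ {0}`), the `ε`-almost-certain outcomes on `|φ7.d(b₂,v₂)⟩` and `|φ7.d(b₃,v₃)⟩`
are EQUAL.  Same chain `C·A·T·A` as `step8_povm_ceiling`; each link now by the two-state bound
`|⟨ψ|φ⟩|² ≤ 4ε⟨ψ|ψ⟩⟨φ|φ⟩` for distinct almost-certain outcomes (`POVM.norm_sq_dotProduct_le_of_almostCertain`)
against the overlap `⟨ψ|ψ⟩⟨φ|φ⟩ ≤ P²|⟨ψ|φ⟩|²` of each move; the last step by uniqueness of an
`ε`-almost-certain outcome for `ε < 1/2`.  `ε = 0` is `step8_povm_ceiling`.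
[cite: ChenQuantumLattice2024, Lemma 3.13 pp. 32–34, eq. (12) p. 17, eq. (35) p. 31][cite: NielsenChuang2010, §2.2.6 p. 90, Box 2.3 p. 87] -/
theorem step8_povm_ceiling_robust (h : S.Admissible) {κ : Type*} [Fintype κ] [DecidableEq κ]
    (U : Finset (Fin (S.n + 1))) (t₁ : Fin S.n) (ht₁ : t₁.succ ∈ U)
    (E : POVM (Fin (S.n + 1) → ZMod S.M) κ) {ε : ℝ} (hε : 4 * ε * ((S.P : ℕ) : ℝ) ^ 2 < 1)
    (hE : S.AlmostSureOn ε U E)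
    {b₂ v₂ b₃ v₃ : Fin (S.n + 1) → ℤ} (hI₂ : S.InClass U b₂ v₂) (hI₃ : S.InClass U b₃ v₃)
    (a : ℤ) (m : Fin (S.n + 1) → ℤ) (hm0 : m 0 = 0) (hmU : ∀ i, i ∉ U → m i = 0)
    (hv : ∀ i, ((v₃ i : ℤ) : ZMod S.M)
      = ((v₂ i + 2 * (S.D : ℤ) * S.D * S.p₁ * (a * b₂ i + m i) : ℤ) : ZMod S.M))
    {k₂ k₃ : κ} (hk₂ : E.AlmostCertain ε (S.inst b₂ v₂).phi7d k₂)
    (hk₃ : E.AlmostCertain ε (S.inst b₃ v₃).phi7d k₃) :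
    k₂ = k₃ := by
  obtain ⟨hb₂U, h₂⟩ := hI₂
  obtain ⟨hb₃U, h₃⟩ := hI₃
  have hb₂0 : b₂ 0 = -1 := h₂.b_head
  have hb₃0 : b₃ 0 = -1 := h₃.b_head
  obtain ⟨r, hr⟩ := h.odd_Q
  have hQ : ((S.Q : ℕ) : ℤ) = 2 * r + 1 := by exact_mod_cast hr
  -- the chain
  let bC : Fin (S.n + 1) → ℤ := Function.update b₂ t₁.succ (b₂ t₁.succ - 2 * (S.p₁ : ℤ))
  let vC : Fin (S.n + 1) → ℤ := fun i => v₂ i + 2 * (S.D : ℤ) * S.D * S.p₁ * a * b₂ i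
  let m' : Fin (S.n + 1) → ℤ := fun i => ((r : ℤ) + 1) * m i
  let bT : Fin (S.n + 1) → ℤ := fun i => b₂ i - 2 * (S.p₁ : ℤ) * m' i
  let vT : Fin (S.n + 1) → ℤ := fun i => vC i + 4 * (S.D : ℤ) * S.D * S.p₁ * m' i
  have hm'0 : m' 0 = 0 := by show ((r : ℤ) + 1) * m 0 = 0; rw [hm0, mul_zero]
  have hvC : ∀ i, (S.D : ℤ) ∣ vC i := fun i =>
    dvd_add (h₂.v'_in_DZ i) ⟨2 * S.D * S.p₁ * a * b₂ i, by ring⟩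
  have hvT : ∀ i, (S.D : ℤ) ∣ vT i := fun i =>
    dvd_add (hvC i) ⟨4 * S.D * S.p₁ * m' i, by ring⟩
  -- admissibility and class membership of the intermediate instances
  have aC : (S.inst bC vC).Admissible := by
    refine S.inst_admissible h ?_ (fun i hi => ?_) hvC
    · show Function.update b₂ t₁.succ (b₂ t₁.succ - 2 * (S.p₁ : ℤ)) 0 = -1
      rw [Function.update_of_ne (Fin.succ_ne_zero t₁).symm, hb₂0]
    · show (2 * (S.p₁ : ℤ)) ∣ Function.update b₂ t₁.succ (b₂ t₁.succ - 2 * (S.p₁ : ℤ)) i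
      by_cases hit : i = t₁.succ
      · subst hit
        rw [Function.update_self]
        exact dvd_sub (h₂.b_tail _ hi) ⟨1, by ring⟩
      · rw [Function.update_of_ne hit]
        exact h₂.b_tail i hi
  have cC : S.InClass U bC vC := by
    refine ⟨fun i hi => ?_, aC⟩
    have hit : i ≠ t₁.succ := fun e => hi (e ▸ ht₁)
    show Function.update b₂ t₁.succ (b₂ t₁.succ - 2 * (S.p₁ : ℤ)) i = S.b i
    rw [Function.update_of_ne hit, hb₂U i hi]
  have a₂C : (S.inst b₂ vC).Admissible := S.inst_admissible h hb₂0 h₂.b_tail hvC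
  have c₂C : S.InClass U b₂ vC := ⟨hb₂U, a₂C⟩
  have aT : (S.inst bT vT).Admissible := by
    refine S.inst_admissible h ?_ (fun i hi => ?_) hvT
    · show b₂ 0 - 2 * (S.p₁ : ℤ) * m' 0 = -1
      rw [hm'0, hb₂0]
      ring
    · exact dvd_sub (h₂.b_tail i hi) ⟨m' i, by ring⟩
  have cT : S.InClass U bT vT := by
    refine ⟨fun i hi => ?_, aT⟩
    show b₂ i - 2 * (S.p₁ : ℤ) * (((r : ℤ) + 1) * m i) = S.b i
    rw [hmU i hi, hb₂U i hi]
    ring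
  have a₃T : (S.inst b₃ vT).Admissible := S.inst_admissible h hb₃0 h₃.b_tail hvT
  have c₃T : S.InClass U b₃ vT := ⟨hb₃U, a₃T⟩
  -- the almost-sure outcomes along the chain
  obtain ⟨o₁, ho₁⟩ := hE bC vC cC
  obtain ⟨o₂, ho₂⟩ := hE b₂ vC c₂C
  obtain ⟨o₃, ho₃⟩ := hE bT vT cT
  obtain ⟨o₄, ho₄⟩ := hE b₃ vT c₃T
  -- the links
  have l₁ : k₂ = o₁ :=
    E.eq_of_almostCertain_of_overlap_le hk₂ ho₁ hε (S.overlap_moveC h h₂ t₁ a)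
      (S.dot_phi7d_ne_zero_moveC h h₂ t₁ a)
  have l₂ : o₁ = o₂ :=
    E.eq_of_almostCertain_of_overlap_le ho₁ ho₂ hε (S.overlap_same_offset h aC a₂C)
      (S.dot_phi7d_ne_zero_same_offset h aC a₂C)
  have l₃ : o₂ = o₃ :=
    E.eq_of_almostCertain_of_overlap_le ho₂ ho₃ hε (S.overlap_moveT h a₂C m' hm'0)
      (S.dot_phi7d_ne_zero_moveT h a₂C m' hm'0)
  have l₄ : o₃ = o₄ :=
    E.eq_of_almostCertain_of_overlap_le ho₃ ho₄ hε (S.overlap_same_offset h aT a₃T)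
      (S.dot_phi7d_ne_zero_same_offset h aT a₃T)
  -- the last instance has the same state as `(b₃, v₃)`
  have hcong : ∀ i, ((vT i : ℤ) : ZMod S.M) = ((v₃ i : ℤ) : ZMod S.M) := by
    intro i
    rw [hv i, ZMod.intCast_eq_intCast_iff_dvd_sub, S.M_coe]
    refine ⟨-(m i), ?_⟩
    show v₂ i + 2 * (S.D : ℤ) * S.D * S.p₁ * (a * b₂ i + m i)
        - (v₂ i + 2 * (S.D : ℤ) * S.D * S.p₁ * a * b₂ i + 4 * (S.D : ℤ) * S.D * S.p₁ * (((r : ℤ) + 1) * m i))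
        = 2 * (S.D : ℤ) * S.D * S.P * -m i
    have hP := S.P_coe
    linear_combination (2 * (S.D : ℤ) * S.D * m i) * hP + (2 * (S.D : ℤ) * S.D * S.p₁ * m i) * hQ
  have hstate : (S.inst b₃ vT).phi7d = (S.inst b₃ v₃).phi7d := S.phi7d_inst_congr b₃ v₃ vT hcong
  rw [← hstate] at hk₃
  have l₅ : o₄ = k₃ :=
    E.almostCertain_unique (eps_lt_half h hε) ((S.inst b₃ vT).phi7d_ne_zero a₃T) ho₄ hk₃
  rw [l₁, l₂, l₃, l₄, l₅]

/-- **Corollary (robust): no measurement of the Step-8 register supplies what Step 9 consumes, even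
approximately.**  For any unknown coordinates `U ∋ t₁+1`, any POVM `ε`-almost sure on the class with
`4εP² < 1`: the admissible instance `(b, v′ + 2D²p₁b)` — SAME `b`, same `step8Output`, DIFFERENT
`step9Needs` — receives the same almost-certain outcome as `S`. [cite: ChenQuantumLattice2024, Lemma 3.13 p. 32, §3.5.9 p. 37] -/
theorem step8_cannot_supply_step9Needs_povm_robust (h : S.Admissible) {κ : Type*} [Fintype κ]
    [DecidableEq κ] (U : Finset (Fin (S.n + 1))) (t₁ : Fin S.n) (ht₁ : t₁.succ ∈ U)
    (E : POVM (Fin (S.n + 1) → ZMod S.M) κ) {ε : ℝ} (hε : 4 * ε * ((S.P : ℕ) : ℝ) ^ 2 < 1)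
    (hE : S.AlmostSureOn ε U E) :
    ∃ v₃ : Fin (S.n + 1) → ℤ, (S.inst S.b v₃).Admissible
      ∧ (S.inst S.b v₃).step8Output = S.step8Output
      ∧ (S.inst S.b v₃).step9Needs ≠ S.step9Needs
      ∧ ∀ k k' : κ, E.AlmostCertain ε S.phi7d k → E.AlmostCertain ε (S.inst S.b v₃).phi7d k' → k = k' := by
  have h₃' : (S.inst S.b (fun i => S.v' i + 2 * (S.D : ℤ) * S.D * S.p₁ * S.b i)).Admissible :=
    S.inst_admissible h h.b_head h.b_tail fun i =>
      dvd_add (h.v'_in_DZ i) ⟨2 * S.D * S.p₁ * S.b i, by ring⟩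
  refine ⟨fun i => S.v' i + 2 * (S.D : ℤ) * S.D * S.p₁ * S.b i, h₃', ?_, ?_, ?_⟩
  · show (((S.v' 0 + 2 * (S.D : ℤ) * S.D * S.p₁ * S.b 0 : ℤ)) : ZMod ((S.D : ℕ) ^ 2 * S.p₁))
        = ((S.v' 0 : ℤ) : ZMod ((S.D : ℕ) ^ 2 * S.p₁))
    rw [ZMod.intCast_eq_intCast_iff_dvd_sub, h.b_head]
    exact ⟨2, by push_cast; ring⟩
  · show (((S.v' 0 + 2 * (S.D : ℤ) * S.D * S.p₁ * S.b 0 : ℤ)) : ZMod S.N) ≠ ((S.v' 0 : ℤ) : ZMod S.N)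
    rw [Ne, ZMod.intCast_eq_intCast_iff_dvd_sub, h.b_head, S.N_coe, S.P_coe]
    rintro ⟨c, hc⟩
    have hD : (0 : ℤ) < S.D := by exact_mod_cast S.D.pos
    have hp : (0 : ℤ) < S.p₁ := by exact_mod_cast S.p₁.pos
    have hQ3 : (3 : ℤ) ≤ S.Q := by exact_mod_cast h.three_le_Q
    have hc' : (S.D : ℤ) * S.D * S.p₁ * (2 - S.Q * c) = 0 := by linear_combination hc
    have h2 : (2 : ℤ) - S.Q * c = 0 := by
      rcases mul_eq_zero.1 hc' with h1 | h1
      · exfalso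
        have : (0 : ℤ) < (S.D : ℤ) * S.D * S.p₁ := by positivity
        exact this.ne' h1
      · exact h1
    have : (S.Q : ℤ) * c = 2 := by linarith
    rcases lt_trichotomy c 0 with hc0 | hc0 | hc0
    · nlinarith
    · rw [hc0, mul_zero] at this
      norm_num at this
    · nlinarith
  · intro k k' hk hk'
    have hS : S.InClass U S.b S.v' := ⟨fun _ _ => rfl, h⟩
    have hS₃ : S.InClass U S.b (fun i => S.v' i + 2 * (S.D : ℤ) * S.D * S.p₁ * S.b i) :=
      ⟨fun _ _ => rfl, h₃'⟩
    exact S.step8_povm_ceiling_robust h U t₁ ht₁ E hε hE hS hS₃ 1 (fun _ => 0) rfl (fun _ _ => rfl)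
      (fun i => by push_cast; ring) hk hk'

/-- The same for the full class (every coordinate `≥ 1` unknown, `n ≥ 1`). [cite: ChenQuantumLattice2024, Lemma 3.13 p. 32, §3.5.9 p. 37] -/
theorem step8_cannot_supply_step9Needs_povm_robust' (h : S.Admissible) (hn : 0 < S.n) {κ : Type*}
    [Fintype κ] [DecidableEq κ] (E : POVM (Fin (S.n + 1) → ZMod S.M) κ) {ε : ℝ}
    (hε : 4 * ε * ((S.P : ℕ) : ℝ) ^ 2 < 1) (hE : S.AlmostSureOn ε Finset.univ E) :
    ∃ v₃ : Fin (S.n + 1) → ℤ, (S.inst S.b v₃).Admissible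
      ∧ (S.inst S.b v₃).step8Output = S.step8Output
      ∧ (S.inst S.b v₃).step9Needs ≠ S.step9Needs
      ∧ ∀ k k' : κ, E.AlmostCertain ε S.phi7d k → E.AlmostCertain ε (S.inst S.b v₃).phi7d k' → k = k' :=
  S.step8_cannot_supply_step9Needs_povm_robust h Finset.univ ⟨0, hn⟩ (Finset.mem_univ _) E hε hE

/-- **Corollary: `step9Needs` cannot be read off `|φ7.d⟩`, even with error.**  No POVM on the Step-8 register
with outcomes in `ℤ_N` returns, on `|φ7.d⟩` of every admissible instance, that instance's `step9Needs =
v′₀ mod N` with Born weight `≥ (1 − ε)⟨φ7.d|φ7.d⟩`, as soon as `4εP² < 1` (`n ≥ 1`).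
[cite: ChenQuantumLattice2024, Lemma 3.13 p. 32, §3.5 p. 22, §3.5.9 p. 37] -/
theorem step9Needs_not_almostSurely_measurable (h : S.Admissible) (hn : 0 < S.n) {ε : ℝ}
    (hε : 4 * ε * ((S.P : ℕ) : ℝ) ^ 2 < 1) (E : POVM (Fin (S.n + 1) → ZMod S.M) (ZMod S.N)) :
    ¬ ∀ b₂ v₂ : Fin (S.n + 1) → ℤ, (S.inst b₂ v₂).Admissible →
        E.AlmostCertain ε (S.inst b₂ v₂).phi7d (S.inst b₂ v₂).step9Needs := by
  intro H
  have hE : S.AlmostSureOn ε Finset.univ E := fun b₂ v₂ hI => ⟨_, H b₂ v₂ hI.2⟩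
  obtain ⟨v₃, h₃, -, hne, hk⟩ := S.step8_cannot_supply_step9Needs_povm_robust' h hn E hε hE
  exact hne (hk _ _ (H S.b S.v' h) (H S.b v₃ h₃)).symm

end Shape

end Literature.Computability.Cryptography.Chen2024
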